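/-
Copyright (c) 2026. All rights reserved.
Released under Apache 2.0 license as described in the file LICENSE.
Authors: abc-iut cell, prover seat abc-iut-f-066 (gen 8; row «C55iii-TELECORE@ARC+TWO-SIDED» (a2)(i), abc-iut-L4-lead m205 (2)),
the two-sided twin of abc-iut-L4-t5's `LogFrobeniusAnTelecoreObservablesGenuine.lean` (file 10 of row «F3757-PORT») and of this
seat's `LogFrobeniusAnTelecoreObservablesArchGenuine.lean`; every input is consumed BY NAME (abc-iut-L4-t5, abc-iut-w5-d053,
abc-iut-w5-d144, abc-iut-L4-t3 lineages and this seat's `LogFrobeniusSettingProdTS.lean`) — nothing restated.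
-/
import Literature.AnabelianGeometry.AbsoluteAnabelian.LogFrobeniusAnTelecoreObservablesGenuine
import Literature.AnabelianGeometry.AbsoluteAnabelian.LogFrobeniusSettingProdTS
import Literature.AnabelianGeometry.AbsoluteAnabelian.ArchimedeanHolFieldFunctorGeometric
import HarnessLib

/-!
# [AbsTopIII] Cor 5.5 (iii), last sentence: `𝔗_{An•}`, the core at `ℰ•`, `S_log`, `S_log⊞` are compatible — AT ONE FROZEN SETTING WITH GENUINE ROWS AT BOTH PLACE TYPES

S. Mochizuki, *Topics in absolute anabelian geometry III: global reconstruction algorithms* [MochizukiAbsTopIII2015]; locators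
`p.N` = pages of the author's manuscript (`paper:url-5493eb38cbb7`), read on the page (cell render
`AbsTopIII-kurims-url-5493eb38cbb7`): Cor 5.5 (iii) p. 131 l. 30–40 ("the families of homotopies that constitute `S_log` and
`S_log⊞` are compatible with one another as well as with the families of homotopies that constitute the core and telecore
structures of (i), (ii)"), Def 3.5 (ii) p. 75 ("compatible"), Rmk 3.5.1 p. 78, Prop 5.8 (vii) p. 141 (the product over the two
place types).

PROOF-ONLY file (no definition, no instance, no named-fact hypothesis).  abc-iut-w5-d144 typed the last sentence of Cor 5.5 (iii),
inside `D_{An•}`, as the assumption `Cor55ObservablesTelecoreCompatible L TS` (FACT-LIST F-3757); abc-iut-L4-t5 proved the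
SUFFICIENCY `cor55ObservablesTelecoreCompatible_of` (file 8), the over-ness bridges (file 9), and discharged every binder at the
genuine open-augmentation carrier (ALL places nonarchimedean, file 10); this seat discharged them at the genuine-ARCHIMEDEAN
carrier `archGenuine 𝔄` (`LogFrobeniusAnTelecoreObservablesArchGenuine.lean`).  HERE the binders are discharged at abc-iut-L4-t5's
TWO-SIDED genuine setting `genuineTwoSided p 𝔄 V isArc = nonarchGenuineMonoAnPf.prod archGenuineMonoAnChart` — ONE frozen
`LogFrobeniusSetting` carrying abc-iut-w4-d095's GENUINE nonarchimedean rows (`𝒳 = 𝒞^{MLF}_p`) and abc-iut-w6-d025's GENUINE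
archimedean chart rows over an arbitrary Aut-holomorphic field functor `𝔄` — for EVERY index set `Vmod ≠ ∅`, EVERY `isArc`, and
ANY `TS`-datum `T` with `T.IotaOverTS`, in particular the setting's own `genuineTwoSidedTS p 𝔄 V isArc` (this seat's
`LogFrobeniusSettingProdTS.lean`: the product `TS`-datum; `genuineTwoSided_iotaOver`, `genuineTwoSided_lamOverLink`,
`genuineTwoSidedTS_iotaOverTS`):
* `Hplus v :=` abc-iut-f-101's `logObsFamily v` over abc-iut-L4-t5's `genuineTwoSided_iotaSquaresCommute`; `Hts v := logObsFamilyTS v T`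
  over `genuineTwoSided_iotaSquaresCommuteTS`; `hpush :=` abc-iut-w5-d144's `subFamily_pushFamily_logObsFamilyTS`; `hobs :=` the generic
  `isLogObservablePlus_logObsFamily` / `isLogObservableTS_logObsFamilyTS`; `hreflPlus` / `hreflTS` := file 10's `logObsFamily(TS)_E_refl`;
* `hoverPlus` / `hoverTS` := file 9's bridges over abc-iut-w5-d144's `isOver_logObsFamily_η` / `isOver_logObsFamilyTS_η`, fed with
  `genuineTwoSided_iotaOver`, `genuineTwoSided_lamOverLink` and `T.IotaOverTS`.
Results: `genuineTwoSided_iotaSquaresCommuteTS`, `genuineTwoSided_isLogObservable_pair`, `genuineTwoSided_hoverPlus`,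
`genuineTwoSided_hoverTS`; ★ `cor55ObservablesTelecoreCompatible_genuineTwoSided_of_iotaOverTS` (every `T` with `T.IotaOverTS`);
★★ `cor55ObservablesTelecoreCompatible_genuineTwoSided` (the setting's own `TS`-datum; zero hypotheses beyond `Vmod ≠ ∅`);
`…_iff` (⟺ `Vmod ≠ ∅`); `exists_twoSidedProd_cor55ObservablesTelecoreCompatible` (index `V₁ ⊕ V₂`, nonarchimedean on `V₁`,
archimedean on `V₂`); the concrete geometric instance `HolRS.cor55ObservablesTelecoreCompatible_genuineTwoSided_geometric` (all
connected Riemann surfaces, any prime, one place of each type).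

HONEST LABELS: MODEL-LEVEL at a carrier of the cell's own construction (two-factor proxy of the global `Th•_T[Z]`, abc-iut-L4-t5's
honest limit (P1)); FROZEN interface — at an archimedean `v` the `ι⊞_{v,ε}` are indexed by the frozen `LogFrobeniusSetting`'s edge
set (cell typing finding T3g9-F1; abc-iut-L4-lead m202/m205: the frozen interface is the print reading for THIS sentence, which
has no `ι`/`η` arc obstruction).  The typed statement is abc-iut-w5-d144's reading of the printed sentence; refereed pre-IUT
material; nothing here bears on [IUTchIII] Cor. 3.12; no side taken; typed ≠ proved for print's theaters.
-/

set_option autoImplicit false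

open CategoryTheory


namespace Literature.AnabelianGeometry.AbsoluteAnabelian

namespace LogFrobeniusSetting

open AbsTopIII DiagramOfCategories Quiver

/-! ## At the two-sided genuine setting (frozen PROD) -/

section Instance

variable (p : ℕ) [Fact p.Prime] (𝔄 : AutHolFieldFunctor.{0}) (Vmod : Type 1) (isArc : Vmod → Bool)

/-- The `TS` ι-diamond law at the two-sided genuine setting, every place, every `TS`-datum (from abc-iut-L4-t5's
`genuineTwoSided_iotaSquaresCommute` by `iotaSquaresCommuteTS_of_iotaSquaresCommute`). [cite: MochizukiAbsTopIII2015, Definition 5.4 (iii) p.126] -/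
theorem genuineTwoSided_iotaSquaresCommuteTS (T : (genuineTwoSided p 𝔄 Vmod isArc).TSHomotopies) (v : Vmod) :
    (genuineTwoSided p 𝔄 Vmod isArc).IotaSquaresCommuteTS T v :=
  (genuineTwoSided p 𝔄 Vmod isArc).iotaSquaresCommuteTS_of_iotaSquaresCommute v T
    (genuineTwoSided_iotaSquaresCommute p 𝔄 Vmod isArc v)

/-- **The pair of observable families at a place `v` of the two-sided genuine setting**: `Hplus v := logObsFamily v` is an
`S_log⊞_v` and `Hts v := logObsFamilyTS v T` is an `S_log_v`. [cite: MochizukiAbsTopIII2015, Cor 5.5 (iii) p. 131] -/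
theorem genuineTwoSided_isLogObservable_pair (T : (genuineTwoSided p 𝔄 Vmod isArc).TSHomotopies) (v : Vmod) :
    (genuineTwoSided p 𝔄 Vmod isArc).IsLogObservablePlus v
        ((genuineTwoSided p 𝔄 Vmod isArc).logObsFamily v (genuineTwoSided_iotaSquaresCommute p 𝔄 Vmod isArc v)) ∧
      (genuineTwoSided p 𝔄 Vmod isArc).IsLogObservableTS T v
        ((genuineTwoSided p 𝔄 Vmod isArc).logObsFamilyTS v T (genuineTwoSided_iotaSquaresCommuteTS p 𝔄 Vmod isArc T v)) :=
  ⟨(genuineTwoSided p 𝔄 Vmod isArc).isLogObservablePlus_logObsFamily v (genuineTwoSided_iotaSquaresCommute p 𝔄 Vmod isArc v),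
    (genuineTwoSided p 𝔄 Vmod isArc).isLogObservableTS_logObsFamilyTS v T
      (genuineTwoSided_iotaSquaresCommuteTS p 𝔄 Vmod isArc T v)⟩

/-- **`hoverPlus` at the two-sided genuine setting**: every homotopy of the universal `⊞`-observable family `S_log⊞_v`, read inside
`D_{An•}`, lies over `Th•[Z]` for file 1's `anOverE` — file 9's bridge over abc-iut-w5-d144's `isOver_logObsFamily_η`, fed with
`genuineTwoSided_iotaOver` and `genuineTwoSided_lamOverLink`. [cite: MochizukiAbsTopIII2015, Remark 3.5.1 p.78] -/
theorem genuineTwoSided_hoverPlus (v : Vmod) (a : (logShapePlus (isArc := isArc) v).Vertex)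
    (q r : Quiver.Path a (logShapePlus (isArc := isArc) v).obs)
    (h : ((genuineTwoSided p 𝔄 Vmod isArc).logObsFamily v (genuineTwoSided_iotaSquaresCommute p 𝔄 Vmod isArc v)).E q r) :
    (genuineTwoSided p 𝔄 Vmod isArc).anOverE.IsOver ((plusEmb (Vmod := Vmod) (isArc := isArc) v).mapPath q)
      ((plusEmb (Vmod := Vmod) (isArc := isArc) v).mapPath r)
      ((genuineTwoSided p 𝔄 Vmod isArc).embPlusHomAn v
        ((genuineTwoSided p 𝔄 Vmod isArc).logObsFamily v (genuineTwoSided_iotaSquaresCommute p 𝔄 Vmod isArc v)) h) :=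
  (genuineTwoSided p 𝔄 Vmod isArc).isOver_embPlusHomAn_of_isOver v _ h
    ((genuineTwoSided p 𝔄 Vmod isArc).isOver_logObsFamily_η v (genuineTwoSided_iotaOver p 𝔄 Vmod isArc)
      (genuineTwoSided_lamOverLink p 𝔄 Vmod isArc) _ h)

/-- **`hoverTS` at the two-sided genuine setting**, for every `TS`-datum `T` whose `ι` lie over `Th•[Z]` (`T.IotaOverTS`).
[cite: MochizukiAbsTopIII2015, Remark 3.5.1 p.78] -/
theorem genuineTwoSided_hoverTS (T : (genuineTwoSided p 𝔄 Vmod isArc).TSHomotopies) (hT : T.IotaOverTS) (v : Vmod)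
    (a : (logShapeTS (isArc := isArc) v).Vertex) (q r : Quiver.Path a (logShapeTS (isArc := isArc) v).obs)
    (h : ((genuineTwoSided p 𝔄 Vmod isArc).logObsFamilyTS v T
      (genuineTwoSided_iotaSquaresCommuteTS p 𝔄 Vmod isArc T v)).E q r) :
    (genuineTwoSided p 𝔄 Vmod isArc).anOverE.IsOver ((tsEmb (Vmod := Vmod) (isArc := isArc) v).mapPath q)
      ((tsEmb (Vmod := Vmod) (isArc := isArc) v).mapPath r)
      ((genuineTwoSided p 𝔄 Vmod isArc).embTSHomAn v
        ((genuineTwoSided p 𝔄 Vmod isArc).logObsFamilyTS v T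
          (genuineTwoSided_iotaSquaresCommuteTS p 𝔄 Vmod isArc T v)) h) :=
  (genuineTwoSided p 𝔄 Vmod isArc).isOver_embTSHomAn_of_isOver v _ h
    ((genuineTwoSided p 𝔄 Vmod isArc).isOver_logObsFamilyTS_η v T hT (genuineTwoSided_lamOverLink p 𝔄 Vmod isArc) _ h)

/-- ★ **Cor 5.5 (iii), last sentence, inside `D_{An•}`, AT THE TWO-SIDED GENUINE SETTING, for every `TS`-datum `T` with
`T.IotaOverTS`** (`Vmod ≠ ∅`, every `isArc`, every prime `p`, every Aut-holomorphic field functor `𝔄`): ONE family of homotopies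
on `D_{An•}` contains the telecore family `𝒥` of `𝔗_{An•}`, the embedded core family of `ℰ•` and the embedded `S_log⊞_v`, `S_log_v`
at every `v` — abc-iut-L4-t5's sufficiency theorem with every binder discharged. [cite: MochizukiAbsTopIII2015, Cor 5.5 (iii) p. 131] -/
theorem cor55ObservablesTelecoreCompatible_genuineTwoSided_of_iotaOverTS [Nonempty Vmod]
    (T : (genuineTwoSided p 𝔄 Vmod isArc).TSHomotopies) (hT : T.IotaOverTS) :
    (genuineTwoSided p 𝔄 Vmod isArc).Cor55ObservablesTelecoreCompatible T :=
  (genuineTwoSided p 𝔄 Vmod isArc).cor55ObservablesTelecoreCompatible_of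
    (Hplus := fun v =>
      (genuineTwoSided p 𝔄 Vmod isArc).logObsFamily v (genuineTwoSided_iotaSquaresCommute p 𝔄 Vmod isArc v))
    (Hts := fun v =>
      (genuineTwoSided p 𝔄 Vmod isArc).logObsFamilyTS v T (genuineTwoSided_iotaSquaresCommuteTS p 𝔄 Vmod isArc T v))
    (hpush := fun v => (genuineTwoSided p 𝔄 Vmod isArc).subFamily_pushFamily_logObsFamilyTS v T _ _)
    (hoverPlus := fun v a q r h => genuineTwoSided_hoverPlus p 𝔄 Vmod isArc v a q r h)
    (hoverTS := fun v a q r h => genuineTwoSided_hoverTS p 𝔄 Vmod isArc T hT v a q r h)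
    (hreflPlus := fun v _ q => (genuineTwoSided p 𝔄 Vmod isArc).logObsFamily_E_refl v _ q)
    (hreflTS := fun v _ q => (genuineTwoSided p 𝔄 Vmod isArc).logObsFamilyTS_E_refl v T _ q)
    (TS := T)
    (hobs := fun v => genuineTwoSided_isLogObservable_pair p 𝔄 Vmod isArc T v)

/-- ★★ **Cor 5.5 (iii), last sentence, inside `D_{An•}`, AT THE TWO-SIDED GENUINE SETTING with its own `TS`-datum**
(`genuineTwoSidedTS p 𝔄 V isArc`, whose `ι` lie over `Th•[Z]` by `genuineTwoSidedTS_iotaOverTS`; zero hypotheses beyond `Vmod ≠ ∅`).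
[cite: MochizukiAbsTopIII2015, Cor 5.5 (iii) p. 131] -/
theorem cor55ObservablesTelecoreCompatible_genuineTwoSided [Nonempty Vmod] :
    (genuineTwoSided p 𝔄 Vmod isArc).Cor55ObservablesTelecoreCompatible (genuineTwoSidedTS p 𝔄 Vmod isArc) :=
  cor55ObservablesTelecoreCompatible_genuineTwoSided_of_iotaOverTS p 𝔄 Vmod isArc (genuineTwoSidedTS p 𝔄 Vmod isArc)
    (genuineTwoSidedTS_iotaOverTS p 𝔄 Vmod isArc)

/-- **The statement at the two-sided genuine setting EXACTLY**: it holds iff `Vmod ≠ ∅` (abc-iut-w5-d144's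
`not_cor55ObservablesTelecoreCompatible_of_isEmpty` is the degenerate corner). [cite: MochizukiAbsTopIII2015, Cor 5.5 (iii) p. 131] -/
theorem cor55ObservablesTelecoreCompatible_genuineTwoSided_iff :
    (genuineTwoSided p 𝔄 Vmod isArc).Cor55ObservablesTelecoreCompatible (genuineTwoSidedTS p 𝔄 Vmod isArc) ↔
      Nonempty Vmod := by
  refine ⟨fun h => ?_, fun _ => cor55ObservablesTelecoreCompatible_genuineTwoSided p 𝔄 Vmod isArc⟩
  by_contra hV
  haveI : IsEmpty Vmod := not_nonempty_iff.mp hV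
  exact (genuineTwoSided p 𝔄 Vmod isArc).not_cor55ObservablesTelecoreCompatible_of_isEmpty
    (genuineTwoSidedTS p 𝔄 Vmod isArc) h

end Instance

/-- Hence a §5 setting over a TWO-SIDED index `V₁ ⊕ V₂` (`isArc := Sum.elim (fun _ => false) (fun _ => true)`: nonarchimedean on
`V₁`, archimedean on `V₂`) with GENUINE rows at both place types and a `TS`-datum satisfying the typed Cor 5.5 (iii)
telecore-compatibility clause EXIST whenever `V₁ ⊕ V₂ ≠ ∅`. [cite: MochizukiAbsTopIII2015, Cor 5.5 (iii) p. 131] -/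
theorem exists_twoSidedProd_cor55ObservablesTelecoreCompatible (p : ℕ) [Fact p.Prime] (𝔄 : AutHolFieldFunctor.{0})
    (V₁ V₂ : Type 1) [Nonempty (V₁ ⊕ V₂)] :
    ∃ (L : LogFrobeniusSetting (V₁ ⊕ V₂) (Sum.elim (fun _ => false) (fun _ => true))) (T : L.TSHomotopies),
      L.Cor55ObservablesTelecoreCompatible T :=
  ⟨genuineTwoSided p 𝔄 (V₁ ⊕ V₂) _, genuineTwoSidedTS p 𝔄 (V₁ ⊕ V₂) _,
    cor55ObservablesTelecoreCompatible_genuineTwoSided p 𝔄 (V₁ ⊕ V₂) _⟩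

end LogFrobeniusSetting

/-! ## The concrete geometric instance -/

namespace HolRS

open LogFrobeniusSetting

/-- **Concrete, no variable left but the prime and the object property**: at the geometric Aut-holomorphic field functor on
connected Riemann surfaces (`geometricAutHolFieldFunctor Q`), ONE nonarchimedean and ONE archimedean place, the typed last sentence
of Cor 5.5 (iii) holds at the two-sided genuine setting with its own `TS`-datum. [cite: MochizukiAbsTopIII2015, Cor 5.5 (iii) p. 131] -/
theorem cor55ObservablesTelecoreCompatible_genuineTwoSided_geometric (p : ℕ) [Fact p.Prime] (Q : ObjectProperty HolRS) :
    (genuineTwoSided p (geometricAutHolFieldFunctor Q) (PUnit.{2} ⊕ PUnit.{2})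
        (Sum.elim (fun _ => false) (fun _ => true))).Cor55ObservablesTelecoreCompatible
      (genuineTwoSidedTS p (geometricAutHolFieldFunctor Q) (PUnit.{2} ⊕ PUnit.{2})
        (Sum.elim (fun _ => false) (fun _ => true))) :=
  cor55ObservablesTelecoreCompatible_genuineTwoSided p (geometricAutHolFieldFunctor Q) _ _

end HolRS

end Literature.AnabelianGeometry.AbsoluteAnabelian
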